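import Mathlib.Analysis.Convex.Slope
import Mathlib.Analysis.Convex.Deriv
import Literature.MathematicalPhysics.QuantumLattice.HubbardNNNHoppingThermodynamicLimit
import HarnessLib

/-!
# Convexity in the density of the ground-state energy density of the 2D `t–t'` Hubbard model

Topic `MathematicalPhysics/QuantumLattice` (family `hubbard`); the `t–t'` twin of
`HubbardTorus2DEnergyDensityConvex.lean` (which is the case `t' = 0`, `energyDensityTT'_zero`). For
`U ≥ 0` the thermodynamic limit `n ↦ e(t, t', U, n) = energyDensityTT' t t' U n`
(`HubbardNNNHoppingThermodynamicLimit.lean`) of the canonical ground-state energy per site of the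
Hubbard model with nearest (`t`) and next-nearest (`t'`) neighbour hopping on the tori `ℤ/Lℤ × ℤ/Lℤ`
is **convex on `[0, 2)`** (`convexOn_energyDensityTT'`):

* `energyDensityTT'_le_add` — the one-sided Lipschitz bound `e(z) ≤ e(y) + A(z)(z - y)` for
  `y ≤ z` (iterated one-particle additions, `groundEnergy_hubbardRectTorusTT'_square_add_le`; the cost
  constant is the tree's `addCost (|t| + |t'|) U z = 36(2|t| + 2|t'| + |U|)/(2 - z)`);
* `groundEnergy_hubbardRectTorusTT'_rows_div_le`, `energyDensityTT'_ratConvex` — convexity at the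
  rational weights `a/K`: tile the `KM × KM` torus by `K²` blocks, `a` rows of blocks at density `x`
  and `K - a` rows at density `y` (`groundEnergy_hubbardRectTorusTT'_square_tiling`, defect
  `(16|t| + 32|t'|) M k (k+1)`), add the `≤ 2K²` rounding particles, and let `M → ∞`;
* `convexOn_energyDensityTT'` — real weights by approximating the rational point from below and
  the one-sided Lipschitz bound;
* `exists_supporting_line_energyDensityTT'` — the supporting line at every interior density (input
  of the infinite-volume variational principle for `energyDensityTT'`).

(Ruelle, *Statistical Mechanics* (1969), §3.3–3.4: the limiting energy density of a lattice system
is convex in the density.) Everything is proved; no definition. [cite: Ruelle1969, §3.3]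
-/

noncomputable section

namespace Literature.MathematicalPhysics.QuantumLattice

open Matrix Finset Filter Topology
open scoped BigOperators

namespace ThermodynamicLimit

/-- The one-particle addition cost of the `t–t'` torus in terms of the tree's `addCost`:
`36(2|t| + |U| + 2|t'|)/(2 - n) = addCost (|t| + |t'|) U n`, so that
`E(N + d) ≤ E(N) + d · addCost (|t| + |t'|) U n` below density `n < 2`. [cite: Ruelle1969, §3.4] -/
theorem groundEnergy_hubbardRectTorusTT'_square_add_le' (L : ℕ) (t t' U : ℝ) {n : ℝ} (hn : n < 2)
    {N d : ℕ} (h : ((N + d : ℕ) : ℝ) ≤ n * (L : ℝ) ^ 2) :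
    groundEnergy (hubbardRectTorusTT' L L t t' U) (N + d) ≤
      groundEnergy (hubbardRectTorusTT' L L t t' U) N + d * addCost (|t| + |t'|) U n := by
  have h1 := groundEnergy_hubbardRectTorusTT'_square_add_le L t t' U hn h
  have hA : addCost (|t| + |t'|) U n = 36 * (2 * |t| + |U| + 2 * |t'|) / (2 - n) := by
    rw [addCost, abs_of_nonneg (by positivity : (0 : ℝ) ≤ |t| + |t'|)]
    ring
  rwa [← hA] at h1


/-- **One-sided Lipschitz bound (adding density).** For `0 ≤ y ≤ z < 2`:
`e(z) ≤ e(y) + A(z) (z - y)`. [cite: Ruelle1969, §3.4] -/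
theorem energyDensityTT'_le_add (t t' : ℝ) {U : ℝ} (hU : 0 ≤ U) {y z : ℝ} (hy : 0 ≤ y) (hyz : y ≤ z)
    (hz : z < 2) :
    energyDensityTT' t t' U z ≤ energyDensityTT' t t' U y + addCost (|t| + |t'|) U z * (z - y) := by
  have hz0 : 0 ≤ z := hy.trans hyz
  have hy2 : y < 2 := hyz.trans_lt hz
  have hf := tendsto_energyDensityTT' t t' hU hz0 hz
  have hA0 := addCost_nonneg (|t| + |t'|) U hz
  have hg : Tendsto (fun L : ℕ => groundEnergy (hubbardRectTorusTT' L L t t' U) (rectN y L) /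
      (L : ℝ) ^ 2 + addCost (|t| + |t'|) U z * (z - y + (2 : ℝ) / L)) atTop
      (𝓝 (energyDensityTT' t t' U y + addCost (|t| + |t'|) U z * (z - y + 0))) :=
    (tendsto_energyDensityTT' t t' hU hy hy2).add (tendsto_const_nhds.mul
      (tendsto_const_nhds.add (tendsto_const_div_atTop_nhds_zero_nat 2)))
  rw [add_zero] at hg
  refine le_of_tendsto_of_tendsto hf hg (eventually_atTop.2 ⟨1, fun L hL => ?_⟩)
  have hLpos : (0 : ℝ) < L := by exact_mod_cast hL
  obtain ⟨d, hd⟩ : ∃ d, rectN z L = rectN y L + d := ⟨rectN z L - rectN y L, by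
    have := rectN_mono hyz L; omega⟩
  have hadd := groundEnergy_hubbardRectTorusTT'_square_add_le' L t t' U hz (N := rectN y L) (d := d)
    (by rw [← hd]; exact rectN_le hz0 L)
  rw [← hd] at hadd
  have hdle : (d : ℝ) ≤ (z - y) * (L : ℝ) ^ 2 + 2 := by
    have h1 := rectN_le hz0 L
    have h2 := lt_rectN_add_two y L
    have : (rectN z L : ℝ) = rectN y L + d := by exact_mod_cast hd
    nlinarith
  set Ez := groundEnergy (hubbardRectTorusTT' L L t t' U) (rectN z L) with hEz
  set Ey := groundEnergy (hubbardRectTorusTT' L L t t' U) (rectN y L) with hEy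
  show Ez / (L : ℝ) ^ 2 ≤ Ey / (L : ℝ) ^ 2 + addCost (|t| + |t'|) U z * (z - y + 2 / L)
  have hL1 : (1 : ℝ) ≤ L := by exact_mod_cast hL
  have h3 : (d : ℝ) * addCost (|t| + |t'|) U z ≤
      addCost (|t| + |t'|) U z * ((z - y) * (L : ℝ) ^ 2 + 2 * L) := by
    rw [mul_comm]
    exact mul_le_mul_of_nonneg_left (by nlinarith) hA0
  have key : Ez ≤ Ey + addCost (|t| + |t'|) U z * ((z - y) * (L : ℝ) ^ 2 + 2 * L) := by linarith
  have hL2 : (0 : ℝ) < (L : ℝ) ^ 2 := by positivity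
  have : Ey / (L : ℝ) ^ 2 + addCost (|t| + |t'|) U z * (z - y + 2 / L) =
      (Ey + addCost (|t| + |t'|) U z * ((z - y) * (L : ℝ) ^ 2 + 2 * L)) / (L : ℝ) ^ 2 := by
    field_simp
  rw [this, div_le_div_iff_of_pos_right hL2]
  exact key


/-- Row sums: `Σ_{i < K} (if i < a then X else Y) = a X + (K - a) Y` for `a ≤ K`. [folklore] -/
private theorem sum_fin_ite_lt' {β : Type*} [AddCommMonoid β] (K a : ℕ) (ha : a ≤ K) (X Y : β) :
    ∑ i : Fin K, (if (i : ℕ) < a then X else Y) = a • X + (K - a) • Y := by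
  rw [Fin.sum_univ_eq_sum_range (f := fun i => if i < a then X else Y), Finset.range_eq_Ico,
    ← Finset.sum_Ico_consecutive _ (Nat.zero_le a) ha]
  congr 1
  · rw [Finset.sum_congr rfl (fun i hi => if_pos (Finset.mem_Ico.1 hi).2), Finset.sum_const,
      Nat.card_Ico, Nat.sub_zero]
  · rw [Finset.sum_congr rfl (fun i hi => if_neg (not_lt.2 (Finset.mem_Ico.1 hi).1)),
      Finset.sum_const, Nat.card_Ico]

/-- **The row-tiling inequality at finite size.** For densities `x, y ∈ [0,2)`, `K = k+1`, `a ≤ K`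
rows at density `x` and `K - a` rows at density `y` in the `KM × KM` torus (`M ≥ 1`), with
`z = (a x + (K-a) y)/K` and the `≤ 2K²` rounding particles added at cost `A(z)` each:
`E_{KM}(N_{KM}(z))/(KM)² ≤ (a/K) E_M(N_M(x))/M² + ((K-a)/K) E_M(N_M(y))/M² + (16|t| + 2A(z))/M`.
[cite: Ruelle1969, §3.3] -/
theorem groundEnergy_hubbardRectTorusTT'_rows_div_le (t t' U : ℝ) {x y : ℝ} (hx0 : 0 ≤ x)
    (hx2 : x < 2) (hy0 : 0 ≤ y) (hy2 : y < 2) (k a : ℕ) (ha : a ≤ k + 1) {M : ℕ} (hM : 1 ≤ M) :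
    groundEnergy (hubbardRectTorusTT' ((k + 1) * M) ((k + 1) * M) t t' U)
        (rectN ((a * x + ((k + 1 : ℕ) - a) * y) / (k + 1 : ℕ)) ((k + 1) * M)) /
          (((k + 1) * M : ℕ) : ℝ) ^ 2 ≤
      (a / (k + 1 : ℕ)) * (groundEnergy (hubbardRectTorusTT' M M t t' U) (rectN x M) / (M : ℝ) ^ 2) +
        (((k + 1 : ℕ) - a) / (k + 1 : ℕ)) *
          (groundEnergy (hubbardRectTorusTT' M M t t' U) (rectN y M) / (M : ℝ) ^ 2) +
        ((16 * |t| + 32 * |t'|) + 2 * addCost (|t| + |t'|) U ((a * x + ((k + 1 : ℕ) - a) * y) / (k + 1 : ℕ))) / M := by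
  -- abbreviations (plain `have`-equalities, no `set`)
  have hKpos : (0 : ℝ) < (k + 1 : ℕ) := by positivity
  have haK : (a : ℝ) ≤ (k + 1 : ℕ) := by exact_mod_cast ha
  have hKa : (0 : ℝ) ≤ ((k + 1 : ℕ) : ℝ) - a := by linarith
  have ha0 : (0 : ℝ) ≤ a := Nat.cast_nonneg a
  have hMpos : (0 : ℝ) < M := by exact_mod_cast hM
  have hM1 : (1 : ℝ) ≤ M := by exact_mod_cast hM
  -- the density `z ∈ [0, 2)`
  have hz0 : 0 ≤ (a * x + ((k + 1 : ℕ) - a) * y) / (k + 1 : ℕ) := by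
    apply div_nonneg _ hKpos.le
    have : 0 ≤ (((k + 1 : ℕ) : ℝ) - a) * y := mul_nonneg hKa hy0
    positivity
  have hz2 : (a * x + ((k + 1 : ℕ) - a) * y) / (k + 1 : ℕ) < 2 := by
    rw [div_lt_iff₀ hKpos]
    have h1 : (a : ℝ) * x ≤ a * max x y := mul_le_mul_of_nonneg_left (le_max_left _ _) ha0
    have h2 : (((k + 1 : ℕ) : ℝ) - a) * y ≤ (((k + 1 : ℕ) : ℝ) - a) * max x y :=
      mul_le_mul_of_nonneg_left (le_max_right _ _) hKa
    have : max x y < 2 := max_lt hx2 hy2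
    nlinarith
  have hA0 := addCost_nonneg (|t| + |t'|) U hz2
  -- block particle numbers: `a` rows at `N_M(x)`, the others at `N_M(y)`
  have hNs_le : ∀ i j : Fin (k + 1), (fun i _ => if (i : ℕ) < a then rectN x M else rectN y M) i j ≤
      2 * (M * M) := by
    intro i j
    dsimp only
    split_ifs
    · exact rectN_le_two_mul hx0 hx2.le M
    · exact rectN_le_two_mul hy0 hy2.le M
  have hsumN : ∑ i : Fin (k + 1), ∑ _j : Fin (k + 1), (if (i : ℕ) < a then rectN x M else rectN y M) =
      (k + 1) * (a * rectN x M + (k + 1 - a) * rectN y M) := by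
    simp only [Finset.sum_const, Finset.card_univ, Fintype.card_fin, smul_eq_mul]
    rw [← Finset.mul_sum, sum_fin_ite_lt' (k + 1) a ha, smul_eq_mul, smul_eq_mul]
  have hsumE : ∑ i : Fin (k + 1), ∑ _j : Fin (k + 1), groundEnergy (hubbardRectTorusTT' M M t t' U)
      (if (i : ℕ) < a then rectN x M else rectN y M) =
      ((k + 1 : ℕ) : ℝ) * (a * groundEnergy (hubbardRectTorusTT' M M t t' U) (rectN x M) +
        (((k + 1 : ℕ) : ℝ) - a) * groundEnergy (hubbardRectTorusTT' M M t t' U) (rectN y M)) := by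
    have : ∀ i : Fin (k + 1), groundEnergy (hubbardRectTorusTT' M M t t' U)
        (if (i : ℕ) < a then rectN x M else rectN y M) =
        if (i : ℕ) < a then groundEnergy (hubbardRectTorusTT' M M t t' U) (rectN x M) else
          groundEnergy (hubbardRectTorusTT' M M t t' U) (rectN y M) := fun i => by
      split_ifs <;> rfl
    simp only [Finset.sum_const, Finset.card_univ, Fintype.card_fin, nsmul_eq_mul, this]
    rw [← Finset.mul_sum, sum_fin_ite_lt' (k + 1) a ha, nsmul_eq_mul, nsmul_eq_mul, Nat.cast_sub ha]
  -- `P ≤ N_{KM}(z) ≤ P + 2K²`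
  have hPr : (((k + 1) * (a * rectN x M + (k + 1 - a) * rectN y M) : ℕ) : ℝ) =
      (k + 1 : ℕ) * (a * rectN x M + (((k + 1 : ℕ) : ℝ) - a) * rectN y M) := by
    push_cast [Nat.cast_sub ha]; ring
  have hzKM : (a * x + ((k + 1 : ℕ) - a) * y) / (k + 1 : ℕ) * ((((k + 1) * M : ℕ) : ℝ)) ^ 2 =
      (k + 1 : ℕ) * (a * (x * (M : ℝ) ^ 2) + (((k + 1 : ℕ) : ℝ) - a) * (y * (M : ℝ) ^ 2)) := by
    push_cast; field_simp
  have hPle : (k + 1) * (a * rectN x M + (k + 1 - a) * rectN y M) ≤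
      rectN ((a * x + ((k + 1 : ℕ) - a) * y) / (k + 1 : ℕ)) ((k + 1) * M) := by
    have h1 : (((k + 1) * (a * rectN x M + (k + 1 - a) * rectN y M) : ℕ) : ℝ) ≤
        (a * x + ((k + 1 : ℕ) - a) * y) / (k + 1 : ℕ) * ((((k + 1) * M : ℕ) : ℝ)) ^ 2 := by
      rw [hPr, hzKM]
      refine mul_le_mul_of_nonneg_left ?_ hKpos.le
      exact add_le_add (mul_le_mul_of_nonneg_left (rectN_le hx0 M) ha0)
        (mul_le_mul_of_nonneg_left (rectN_le hy0 M) hKa)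
    have hm : (k + 1) * (a * rectN x M + (k + 1 - a) * rectN y M) =
        2 * ((k + 1) * (a * ⌊x * (M : ℝ) ^ 2 / 2⌋₊ + (k + 1 - a) * ⌊y * (M : ℝ) ^ 2 / 2⌋₊)) := by
      simp only [rectN]; ring
    have h1' : (2 * (((k + 1) * (a * ⌊x * (M : ℝ) ^ 2 / 2⌋₊ + (k + 1 - a) * ⌊y * (M : ℝ) ^ 2 / 2⌋₊) : ℕ) : ℝ))
        ≤ (a * x + ((k + 1 : ℕ) - a) * y) / (k + 1 : ℕ) * ((((k + 1) * M : ℕ) : ℝ)) ^ 2 := by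
      rw [hm] at h1; exact_mod_cast h1
    rw [hm]
    exact two_mul_le_rectN_aux h1'
  obtain ⟨d, hd⟩ : ∃ d, rectN ((a * x + ((k + 1 : ℕ) - a) * y) / (k + 1 : ℕ)) ((k + 1) * M) =
      (k + 1) * (a * rectN x M + (k + 1 - a) * rectN y M) + d := ⟨_, (Nat.add_sub_cancel' hPle).symm⟩
  have hdle : (d : ℝ) ≤ 2 * (((k + 1 : ℕ) : ℝ) * (k + 1 : ℕ)) := by
    have h1 := rectN_le hz0 ((k + 1) * M)
    have h2 := lt_rectN_add_two x M
    have h3 := lt_rectN_add_two y M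
    have h4 : ((rectN ((a * x + ((k + 1 : ℕ) - a) * y) / (k + 1 : ℕ)) ((k + 1) * M) : ℕ) : ℝ) =
        (((k + 1) * (a * rectN x M + (k + 1 - a) * rectN y M) : ℕ) : ℝ) + d := by exact_mod_cast hd
    rw [hzKM] at h1
    rw [hPr] at h4
    nlinarith [mul_le_mul_of_nonneg_left h2.le ha0, mul_le_mul_of_nonneg_left h3.le hKa]
  -- energies
  have hadd := groundEnergy_hubbardRectTorusTT'_square_add_le' ((k + 1) * M) t t' U hz2
    (N := (k + 1) * (a * rectN x M + (k + 1 - a) * rectN y M)) (d := d)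
    (by rw [← hd]; exact rectN_le hz0 ((k + 1) * M))
  rw [← hd] at hadd
  have htile := groundEnergy_hubbardRectTorusTT'_square_tiling M t t' U k
    (fun i _ => if (i : ℕ) < a then rectN x M else rectN y M) hNs_le
  rw [hsumN, hsumE] at htile
  have hk : ((k : ℕ) : ℝ) + 1 = (k + 1 : ℕ) := by push_cast; ring
  push_cast at htile
  rw [hk] at htile
  have hkK : (k : ℝ) ≤ (k + 1 : ℕ) := by rw [← hk]; linarith
  have ht0 : 0 ≤ |t| := abs_nonneg t
  have hdA : (d : ℝ) * addCost (|t| + |t'|) U ((a * x + ((k + 1 : ℕ) - a) * y) / (k + 1 : ℕ)) ≤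
      2 * (((k + 1 : ℕ) : ℝ) * (k + 1 : ℕ)) * addCost (|t| + |t'|) U ((a * x + ((k + 1 : ℕ) - a) * y) / (k + 1 : ℕ)) :=
    mul_le_mul_of_nonneg_right hdle hA0
  have h16 : (16 * |t| + 32 * |t'|) * (M : ℝ) * k * (k + 1 : ℕ) ≤ (16 * |t| + 32 * |t'|) * M * (k + 1 : ℕ) * (k + 1 : ℕ) := by gcongr
  -- divide by `(K M)²`
  have hKM2 : (0 : ℝ) < ((((k + 1) * M : ℕ) : ℝ)) ^ 2 := by positivity
  rw [div_le_iff₀ hKM2]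
  have : ((a : ℝ) / (k + 1 : ℕ) * (groundEnergy (hubbardRectTorusTT' M M t t' U) (rectN x M) / (M : ℝ) ^ 2) +
      (((k + 1 : ℕ) : ℝ) - a) / (k + 1 : ℕ) * (groundEnergy (hubbardRectTorusTT' M M t t' U) (rectN y M) /
        (M : ℝ) ^ 2) + ((16 * |t| + 32 * |t'|) + 2 * addCost (|t| + |t'|) U ((a * x + ((k + 1 : ℕ) - a) * y) / (k + 1 : ℕ))) / M) *
        ((((k + 1) * M : ℕ) : ℝ)) ^ 2 =
      (k + 1 : ℕ) * (a * groundEnergy (hubbardRectTorusTT' M M t t' U) (rectN x M) +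
        (((k + 1 : ℕ) : ℝ) - a) * groundEnergy (hubbardRectTorusTT' M M t t' U) (rectN y M)) +
        (16 * |t| + 32 * |t'|) * M * (k + 1 : ℕ) * (k + 1 : ℕ) +
        2 * (((k + 1 : ℕ) : ℝ) * (k + 1 : ℕ)) * addCost (|t| + |t'|) U ((a * x + ((k + 1 : ℕ) - a) * y) / (k + 1 : ℕ)) * M := by
    push_cast; field_simp; ring
  rw [this]
  have hAM : 2 * (((k + 1 : ℕ) : ℝ) * (k + 1 : ℕ)) * addCost (|t| + |t'|) U ((a * x + ((k + 1 : ℕ) - a) * y) / (k + 1 : ℕ))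
      ≤ 2 * (((k + 1 : ℕ) : ℝ) * (k + 1 : ℕ)) * addCost (|t| + |t'|) U ((a * x + ((k + 1 : ℕ) - a) * y) / (k + 1 : ℕ)) * M :=
    le_mul_of_one_le_right (by positivity) hM1
  linarith [hadd, htile, hdA, h16, hAM]

/-- **Convexity at rational weights.** For densities `x, y ∈ [0, 2)`, `K = k + 1` and `a ≤ K`:
`e((a x + (K-a) y)/K) ≤ (a/K) e(x) + ((K-a)/K) e(y)` (the row-tiling inequality along `M → ∞`).
[cite: Ruelle1969, §3.3] -/
theorem energyDensityTT'_ratConvex (t t' : ℝ) {U : ℝ} (hU : 0 ≤ U) {x y : ℝ} (hx0 : 0 ≤ x)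
    (hx2 : x < 2) (hy0 : 0 ≤ y) (hy2 : y < 2) (k a : ℕ) (ha : a ≤ k + 1) :
    energyDensityTT' t t' U ((a * x + ((k + 1 : ℕ) - a) * y) / (k + 1 : ℕ)) ≤
      (a / (k + 1 : ℕ)) * energyDensityTT' t t' U x +
        (((k + 1 : ℕ) - a) / (k + 1 : ℕ)) * energyDensityTT' t t' U y := by
  have hKpos : (0 : ℝ) < (k + 1 : ℕ) := by positivity
  have haK : (a : ℝ) ≤ (k + 1 : ℕ) := by exact_mod_cast ha
  have hKa : (0 : ℝ) ≤ ((k + 1 : ℕ) : ℝ) - a := by linarith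
  have hz0 : 0 ≤ (a * x + ((k + 1 : ℕ) - a) * y) / (k + 1 : ℕ) := by
    apply div_nonneg _ hKpos.le
    have : 0 ≤ (((k + 1 : ℕ) : ℝ) - a) * y := mul_nonneg hKa hy0
    positivity
  have hz2 : (a * x + ((k + 1 : ℕ) - a) * y) / (k + 1 : ℕ) < 2 := by
    rw [div_lt_iff₀ hKpos]
    have h1 : (a : ℝ) * x ≤ a * max x y := mul_le_mul_of_nonneg_left (le_max_left _ _) (by positivity)
    have h2 : (((k + 1 : ℕ) : ℝ) - a) * y ≤ (((k + 1 : ℕ) : ℝ) - a) * max x y :=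
      mul_le_mul_of_nonneg_left (le_max_right _ _) hKa
    have : max x y < 2 := max_lt hx2 hy2
    nlinarith
  have hf := (tendsto_energyDensityTT' t t' hU hz0 hz2).comp
    (tendsto_atTop_mono (fun M : ℕ => Nat.le_mul_of_pos_left M (Nat.succ_pos k)) tendsto_id)
  have hg : Tendsto (fun M : ℕ => (a / (k + 1 : ℕ)) * (groundEnergy (hubbardRectTorusTT' M M t t' U)
      (rectN x M) / (M : ℝ) ^ 2) + (((k + 1 : ℕ) - a) / (k + 1 : ℕ)) *
      (groundEnergy (hubbardRectTorusTT' M M t t' U) (rectN y M) / (M : ℝ) ^ 2) +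
      ((16 * |t| + 32 * |t'|) + 2 * addCost (|t| + |t'|) U ((a * x + ((k + 1 : ℕ) - a) * y) / (k + 1 : ℕ))) / M) atTop
      (𝓝 ((a / (k + 1 : ℕ)) * energyDensityTT' t t' U x +
        (((k + 1 : ℕ) - a) / (k + 1 : ℕ)) * energyDensityTT' t t' U y + 0)) :=
    ((tendsto_const_nhds.mul (tendsto_energyDensityTT' t t' hU hx0 hx2)).add
      (tendsto_const_nhds.mul (tendsto_energyDensityTT' t t' hU hy0 hy2))).add
      (tendsto_const_div_atTop_nhds_zero_nat _)
  rw [add_zero] at hg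
  refine le_of_tendsto_of_tendsto hf hg (eventually_atTop.2 ⟨1, fun M hM => ?_⟩)
  exact groundEnergy_hubbardRectTorusTT'_rows_div_le t t' U hx0 hx2 hy0 hy2 k a ha hM


/-- **Convexity of the `t–t'` ground-state energy density in the density.** For `U ≥ 0` the
thermodynamic limit `n ↦ e(t, t', U, n)` of the canonical ground-state energy per site of the `t–t'`
Hubbard model on the two-dimensional torus is convex on `[0, 2)`: convexity at the rational weights
`a/K` by tiling (`energyDensityTT'_ratConvex`), extended to real weights by approximating from below
and the one-sided Lipschitz bound `energyDensityTT'_le_add`. (Ruelle (1969) §3.3–3.4: the limiting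
energy / free energy density is convex in the density.) [cite: Ruelle1969, §3.3] -/
theorem convexOn_energyDensityTT' (t t' : ℝ) {U : ℝ} (hU : 0 ≤ U) :
    ConvexOn ℝ (Set.Ico (0 : ℝ) 2) (energyDensityTT' t t' U) := by
  refine ⟨convex_Ico 0 2, ?_⟩
  intro x hx y hy a b ha hb hab
  wlog hxy : x ≤ y generalizing x y a b
  · have h := this hy hx hb ha (by linarith) (le_of_not_ge hxy)
    rw [add_comm] at h
    rw [smul_eq_mul, smul_eq_mul] at *
    linarith [h]
  rw [smul_eq_mul, smul_eq_mul, smul_eq_mul, smul_eq_mul]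
  obtain ⟨hx0, hx2⟩ := hx
  obtain ⟨hy0, hy2⟩ := hy
  set w := a * x + b * y with hw
  have hb1 : b ≤ 1 := by linarith
  have hwx : x ≤ w := by simp only [hw]; nlinarith
  have hwy : w ≤ y := by simp only [hw]; nlinarith
  have hw2 : w < 2 := hwy.trans_lt hy2
  have hw0 : 0 ≤ w := hx0.trans hwx
  set ex := energyDensityTT' t t' U x
  set ey := energyDensityTT' t t' U y
  set C : ℝ := |ex| + |ey| + addCost (|t| + |t'|) U w * (y - x) with hC
  have hAw := addCost_nonneg (|t| + |t'|) U hw2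
  have hC0 : 0 ≤ C := by simp only [hC]; have := mul_nonneg hAw (sub_nonneg.2 hxy); positivity
  -- `e(w) ≤ a e(x) + b e(y) + C/(k+1)` for every `k`
  have key : ∀ k : ℕ, energyDensityTT' t t' U w ≤ a * ex + b * ey + C / (k + 1 : ℕ) := by
    intro k
    have hKpos : (0 : ℝ) < (k + 1 : ℕ) := by positivity
    set m : ℕ := ⌊b * (k + 1 : ℕ)⌋₊ with hm
    have hmle : (m : ℝ) ≤ b * (k + 1 : ℕ) := Nat.floor_le (by positivity)
    have hmlt : b * (k + 1 : ℕ) < m + 1 := Nat.lt_floor_add_one _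
    have hmK : m ≤ k + 1 := by
      have : (m : ℝ) ≤ (k + 1 : ℕ) := hmle.trans (by nlinarith)
      exact_mod_cast this
    -- the rational point `z = ((K - m) x + m y)/K ≤ w`
    set z : ℝ := (((k + 1 - m : ℕ) : ℝ) * x + ((k + 1 : ℕ) - ((k + 1 - m : ℕ) : ℝ)) * y) / (k + 1 : ℕ)
      with hz
    have hcast : ((k + 1 - m : ℕ) : ℝ) = (k + 1 : ℕ) - m := by push_cast [Nat.cast_sub hmK]; ring
    have hz' : z = x + (m / (k + 1 : ℕ)) * (y - x) := by
      simp only [hz, hcast]; field_simp; ring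
    have hθ : (m : ℝ) / (k + 1 : ℕ) ≤ b := by rw [div_le_iff₀ hKpos]; exact hmle
    have hθ' : b - 1 / (k + 1 : ℕ) ≤ (m : ℝ) / (k + 1 : ℕ) := by
      have h : b ≤ ((m : ℝ) + 1) / (k + 1 : ℕ) := by rw [le_div_iff₀ hKpos]; linarith
      rw [add_div] at h; linarith
    have ha' : a = 1 - b := by linarith
    have hdiff : a * x + b * y - (x + m / (k + 1 : ℕ) * (y - x)) = (b - m / (k + 1 : ℕ)) * (y - x) := by
      rw [ha']; ring
    have hzw : z ≤ w := by
      rw [hz', hw, ← sub_nonneg, hdiff]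
      exact mul_nonneg (by linarith) (by linarith)
    have hwz : w - z ≤ (y - x) / (k + 1 : ℕ) := by
      rw [hz', hw, hdiff]
      calc (b - m / (k + 1 : ℕ)) * (y - x) ≤ (1 / (k + 1 : ℕ)) * (y - x) :=
            mul_le_mul_of_nonneg_right (by linarith) (by linarith)
        _ = (y - x) / (k + 1 : ℕ) := by ring
    have hz0 : 0 ≤ z := by rw [hz']; have := mul_nonneg (div_nonneg (Nat.cast_nonneg m) hKpos.le) (sub_nonneg.2 hxy); linarith
    -- rational convexity at `z`, then add density up to `w`
    have hrat := energyDensityTT'_ratConvex t t' hU hx0 hx2 hy0 hy2 k (k + 1 - m) (Nat.sub_le _ _)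
    rw [← hz] at hrat
    have hmono := energyDensityTT'_le_add t t' hU hz0 hzw hw2
    -- the weights `(K - m)/K = 1 - m/K`, `m/K` are within `1/K` of `a`, `b`
    have hcoef1 : ((k + 1 - m : ℕ) : ℝ) / (k + 1 : ℕ) = 1 - m / (k + 1 : ℕ) := by
      rw [hcast]; field_simp
    have hcoef2 : (((k + 1 : ℕ) : ℝ) - ((k + 1 - m : ℕ) : ℝ)) / (k + 1 : ℕ) = m / (k + 1 : ℕ) := by
      rw [hcast]; ring_nf
    rw [hcoef1, hcoef2] at hrat
    -- `|(1 - m/K - a) ex + (m/K - b) ey| ≤ (|ex| + |ey|)/K`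
    have hd1 : |(1 - (m : ℝ) / (k + 1 : ℕ) - a) * ex| ≤ |ex| / (k + 1 : ℕ) := by
      rw [abs_mul, div_eq_mul_one_div |ex|, mul_comm |ex|]
      refine mul_le_mul_of_nonneg_right ?_ (abs_nonneg _)
      rw [abs_le]; constructor <;> linarith
    have hd2 : |((m : ℝ) / (k + 1 : ℕ) - b) * ey| ≤ |ey| / (k + 1 : ℕ) := by
      rw [abs_mul, div_eq_mul_one_div |ey|, mul_comm |ey|]
      refine mul_le_mul_of_nonneg_right ?_ (abs_nonneg _)
      rw [abs_le]; constructor <;> linarith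
    have hd1' := le_abs_self ((1 - (m : ℝ) / (k + 1 : ℕ) - a) * ex)
    have hd2' := le_abs_self (((m : ℝ) / (k + 1 : ℕ) - b) * ey)
    have hd3 : addCost (|t| + |t'|) U w * (w - z) ≤ addCost (|t| + |t'|) U w * (y - x) / (k + 1 : ℕ) := by
      rw [mul_div_assoc]; exact mul_le_mul_of_nonneg_left hwz hAw
    have hCK : C / (k + 1 : ℕ) = |ex| / (k + 1 : ℕ) + |ey| / (k + 1 : ℕ) + addCost (|t| + |t'|) U w * (y - x) / (k + 1 : ℕ) := by
      simp only [hC]; rw [add_div, add_div]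
    rw [hCK]
    nlinarith [hrat, hmono, hd1, hd2, hd1', hd2', hd3]
  -- let `k → ∞`
  refine le_of_forall_pos_le_add fun ε hε => ?_
  obtain ⟨k, hk⟩ := exists_nat_gt (C / ε)
  have hk' : C / (k + 1 : ℕ) ≤ ε := by
    rw [div_le_iff₀ (by positivity)]
    rw [div_lt_iff₀ hε] at hk
    push_cast; nlinarith
  linarith [key k]

/-- **Supporting line of the convex `t–t'` energy density**: for `U ≥ 0` and every density
`0 < ρ < 2` there is a slope `s` with `e(ρ) + s (x - ρ) ≤ e(x)` for all `x ∈ [0,2)` (convexity of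
`energyDensityTT' t t' U` on `[0,2)`; `s` is the right derivative at `ρ`). The `t–t'` twin of
`exists_supporting_line_energyDensity2D`. [cite: Ruelle1969, §3.4] -/
theorem exists_supporting_line_energyDensityTT' (t t' : ℝ) {U : ℝ} (hU : 0 ≤ U) {ρ : ℝ} (hρ0 : 0 < ρ)
    (hρ2 : ρ < 2) :
    ∃ s : ℝ, ∀ x ∈ Set.Ico (0 : ℝ) 2, energyDensityTT' t t' U ρ + s * (x - ρ) ≤ energyDensityTT' t t' U x := by
  have hfc := convexOn_energyDensityTT' t t' hU
  have hρint : ρ ∈ interior (Set.Ico (0 : ℝ) 2) := by rw [interior_Ico]; exact ⟨hρ0, hρ2⟩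
  refine ⟨derivWithin (energyDensityTT' t t' U) (Set.Ioi ρ) ρ, fun x hx => ?_⟩
  rcases lt_trichotomy x ρ with hlt | rfl | hgt
  · have h1 := hfc.slope_le_leftDeriv_of_mem_interior hx hρint hlt
    have h2 := hfc.leftDeriv_le_rightDeriv_of_mem_interior hρint
    have h := h1.trans h2
    rw [slope_def_field, div_le_iff₀ (by linarith)] at h
    linarith
  · simp
  · have h := hfc.rightDeriv_le_slope_of_mem_interior hρint (hx : x ∈ Set.Ico (0 : ℝ) 2) hgt
    rw [slope_def_field, le_div_iff₀ (by linarith)] at h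
    linarith

end ThermodynamicLimit

end Literature.MathematicalPhysics.QuantumLattice
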